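import Summits.QuantumFields.YangMills.Theorems.UnitScaleTiltFluctuationComparisonRegPrGlobalSlackKernelLegChiV4
import Summits.QuantumFields.YangMills.Theorems.UnitScaleTiltFluctuationComparisonRegPrGlobalSlackKernelLegRef
import HarnessLib

/-!
# `UnitScaleTiltFluctuationComparisonRegPrGlobalSlackKernelLegRefV4` — THE v4 TWIN (★★OWNER RULING g26-№14 (F-2b); P22b display branch, width seat ym-ust-20520-w2 g4; skeleton v5kD; record-free decls imported from `…KernelLegRef`) of `…KernelLegRef` — THE TWO-RUN ROWS OF 3⁗χ AS PER-RUN ROWS AGAINST RUN-INDEPENDENT REFERENCE OBJECTS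
# (crux `FluctuationComparisonRegPrIntL`, stmt-QuantumFields-20520, skeleton v5kC, STUB 3⁗χ `stub_globalTwoRunSlackFamChiV4`; width seat ym-ust-20520-w1 g0, count-neutral helper)

WHY.  By name, 3⁗χ is `GlobalSlackKernelLeg.K1aLegRowsRChiV4` (★r1 g4, `…KernelLegChi`): five analytic leg rows over ONE chart family `(Φ, e, B)` at the χ-record's canonical
polymerisation.  Three of them — (43) `KernelLegPointwiseΦ`, (44) `CfgDistΦ`, the seventh-order residual row — speak, clause by clause, about ONE run's package.  Two do not:
K1a `FlatKernelLegCauchyΦ` (run `K+1`'s transported flat kernels against run `K`'s) and `CfgDistCauchyΦ` (run `K+1`'s loop variables against run `K`'s).  Over the per-`K`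
`Classical.choice` witnesses of the hypothesis `OfV3ChiAt` (a SEPARATE existential for every `K`) a genuinely cross-`K` row is unprovable in principle (finding F-g4-1, OWNER
RULING g20-№3 §1: a statement about `Classical.choice`'s value is provable only if it holds for EVERY admissible witness).  [King1986]'s own mechanism for Thm 3.4 is not a
bare two-run statement either: Prop. 3.6 (3.56) compares the `k`-step and the `(k+n)`-step graph amplitudes through the slice decomposition (3.58)–(3.61) and is UNIFORM IN `n`,
i.e. each run's `k`-step kernels are within `L^{−γk}` of the `n → ∞` LIMIT kernels — a PER-RUN statement against a run-independent reference.  This file types that reading: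

* §1 `KerHeightFree Ψ` (a reference chart family whose flat kernels of orders 2…6 are EXACTLY matched across the two runs along the bond transport — the limit family),
  the per-run row `KernelRefΦ D Φ Ψ dist κ′ κ a C` (run `K`'s weighted kernels at `(b, Y)` AND run `K+1`'s at `(b+1, refineSet Y)` are each within `C·e^{−κ𝓛}·(L^{−(1+b)})^a`
  of the reference — two clauses, each about ONE run, indexed like the rows of record), `flatKernelLegCauchyΦ_of_heightFree` (a height-free family carries K1a with `C = 0`)
  and **`flatKernelLegCauchyΦ_of_ref`**: `KerHeightFree Ψ → KernelRefΦ D Φ Ψ … C → FlatKernelLegCauchyΦ D Φ … (2C)` (triangle inequality).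
* §2 the same for the loop variables: `RefCfgCoherent BR` (a reference configuration functional of the coarse field, matched across the runs), the per-run row
  `CfgRefΦ D B BR dist b₀ p₀ a C_B`, **`cfgDistCauchyΦ_of_ref`**: `RefCfgCoherent BR → CfgRefΦ … C_B → CfgDistCauchyΦ … (2C_B)`.
* §3 the sockets **`K1aLegRowsRefChiV4`** (ALL FIVE rows per-run; the reference objects `Ψ, BR` are quantified BEFORE the hypothesis `OfV3ChiAt`, so they depend on the family,
  the record and the coupling only — never on the (α) witnesses) and **`K1aLegRowsRefKChiV4`** (kernels per-run, loop variables two-run as before), the reductions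
  `k1aLegRowsRChiV4_of_RefChiV4`, `k1aLegRowsRChiV4_of_RefKChiV4`, and the capstones **`globalTwoRunSlackFamChiV4_of_k1aLegRowsRefChiV4`** / **`…_of_k1aLegRowsRefKChi`** :
  ⟨THE TEXT OF `stub_globalTwoRunSlackFamChiV4` VERBATIM⟩.
CONSEQUENCE FOR THE v4 (α) RECORD (NODE O): 3⁗χ closes over per-`K` choice witnesses as soon as each run's record DISPLAYS, besides (43)/(44)/(M1)+(57), the closeness of its
step charts' flat kernels to a FIXED height-free reference family (a tree `def`, [King1986] Prop. 3.6's limit kernels) and of its loop variables to a FIXED coherent reference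
functional — no recipe for a coherent family and no two-run row inside the record are needed.  HONEST FRAMING: hypothesis schemas + triangle inequalities; nothing of
[Balaban1985UV3] / [King1986] is asserted; registry untouched; YM₃ on T³ (route `UnitScaleTilt`) is a rung, not the Clay problem, not 𝕋⁴, not a mass gap.

References: C. King, CMP 102 (1986) 649–677 [King1986] (Thm 3.4 (3.9) p.656, Prop. 3.6 (3.56) p.662, (3.58)–(3.61) p.663, Prop. 3.9 (3.71)–(3.74) p.665); T. Bałaban,
CMP 102 (1985) 255–275 [Balaban1985UV3] ((43)–(45) pp.266–267, (57) p.270); CMP 109 (1987) 249–301 [Balaban1987RG1] ((0.1) p.251).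
-/

set_option autoImplicit false

noncomputable section

open scoped BigOperators
open Finset
open Literature.MathematicalPhysics.QuantumFieldTheory.Balaban1983to89
open Literature.MathematicalPhysics.QuantumFieldTheory.Balaban1983to89.T3ContinuumYM3Torus
open Literature.MathematicalPhysics.QuantumFieldTheory.Balaban1983to89.T3UnitScaleTilt
open Literature.MathematicalPhysics.QuantumFieldTheory.Balaban1983to89.T3LevelShift
open Literature.MathematicalPhysics.QuantumFieldTheory.Balaban1983to89.T3AlphaInputsAC
open Literature.MathematicalPhysics.QuantumFieldTheory.Balaban1983to89.T3AlphaPolymerSocket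
open Literature.MathematicalPhysics.QuantumFieldTheory.Balaban1983to89.T3AlphaInputsACTwoRun
open Literature.MathematicalPhysics.QuantumFieldTheory.Balaban1983to89.T3AlphaInputsACTwoRunLevel
open Literature.MathematicalPhysics.QuantumFieldTheory.Balaban1985CMP102
open Literature.MathematicalPhysics.QuantumFieldTheory.Balaban1985CMP102.Setting
open Summit.QuantumFields.Balaban3D.Carriers
open Summit.QuantumFields.Balaban3D.Proofs.Primitives
open Summit.QuantumFields.Balaban3D.Proofs.GroupModelLieC (lieC)
open Summit.QuantumFields.Balaban3D.Proofs.Representation33 (jet26)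
open Summit.QuantumFields.YangMills.Theorems
open Summit.QuantumFields.YangMills.Theorems.GlobalSlackKernelMatching
open Summit.QuantumFields.YangMills.Theorems.GlobalSlackCanonicalPolymers

namespace Summit.QuantumFields.YangMills.Theorems.GlobalSlackKernelLeg

/-! ## §1 Flat kernels: a height-free reference family and the per-run closeness row -/

section Kernels

variable {𝕍 : Type} [NormedAddCommGroup 𝕍] [NormedSpace ℂ 𝕍] {F : T3Family} {γ : ℝ}

-- (record-free `KerHeightFree`: imported from the v3 module, not restated)

-- (record-free `KernelRefΦ`: imported from the v3 module, not restated)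

-- (record-free `zero_compContinuousLinearMap_legL`: imported from the v3 module, not restated)

-- (record-free `flatKernelLegCauchyΦ_of_heightFree`: imported from the v3 module, not restated)

-- (record-free `flatKernelLegCauchyΦ_of_ref`: imported from the v3 module, not restated)

end Kernels

/-! ## §2 Loop variables: a coherent reference functional and the per-run closeness row -/

section Configurations

variable {𝕍 : Type} [NormedAddCommGroup 𝕍] [NormedSpace ℂ 𝕍] {F : T3Family} {γ : ℝ}

-- (record-free `RefCfgCoherent`: imported from the v3 module, not restated)

-- (record-free `CfgRefΦ`: imported from the v3 module, not restated)

-- (record-free `cfgDistCauchyΦ_of_ref`: imported from the v3 module, not restated)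

end Configurations

/-! ## §3 The per-run sockets for 3⁗χ and the registered text, by name -/

/-- **3⁗χ IN PER-RUN CURRENCY** (hypothesis schema, never asserted): `K1aLegRowsRChiV4` with its two cross-run rows replaced by per-run closeness rows against reference objects
that are quantified BEFORE the (α) hypothesis — rates `0 < κ′ < κ₁`, nonnegative constants, a threshold `γB`, and for every family / coupling a HEIGHT-FREE reference chart
family `Ψ` and a COHERENT reference configuration functional `BR` such that, for every inhabited χ-package, a coherent `p : ∀ K, PkgAtV3Chi …` and ONE chart family
`(Φ, e, B)` carry: `KernelRefΦ` (each run's kernels near `Ψ`'s), (43) `KernelLegPointwiseΦ`, the residual row `RemainderSmallΦ … (residualRemRows …)`, (44) `CfgDistΦ`,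
`CfgRefΦ` (each run's loop variables near `BR`) — every clause of every row mentions ONE run's package, so each is dischargeable from that run's displayed record rows for
EVERY admissible witness (the F-g4-1 criterion). [cite: King1986, Thm 3.4 (3.9) p.656, Prop. 3.6 (3.56) p.662, Prop. 3.9 (3.71)-(3.74) p.665; Balaban1985UV3, (43)-(45) pp.266-267, (57) p.270] -/
def K1aLegRowsRefChiV4 (L : ℕ) (𝔠 : AlphaConsts L (suGroupModel 2).N) (a₀ a₁ a : ℝ) : Prop :=
  ∃ (κ' κ₁ C A C_R C_s C_B γB : ℝ), 0 < κ' ∧ κ' < κ₁ ∧ 0 ≤ C ∧ 0 ≤ A ∧ 0 ≤ C_R ∧ 0 ≤ C_s ∧ 0 ≤ C_B ∧ 0 < γB ∧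
    ∀ (F : T3Family) (γ : ℝ) (hF : F.L = L) (hγ : 0 < γ), γ ≤ γB → ∀ (hγ1 : γ ≤ (min (hF ▸ 𝔠).gamma0 1) ^ 2),
      ∃ (Ψ : ChartFam ↥(lieC (suGroupModel 2)) F) (BR : CfgFam ↥(lieC (suGroupModel 2)) F), KerHeightFree Ψ ∧ RefCfgCoherent BR ∧
        (AlphaInputsT3AC.OfV4ChiAt F (hF ▸ 𝔠) a₀ a₁ →
          ∃ (p : ∀ K, AlphaInputsT3AC.PkgAtV4Chi F (hF ▸ 𝔠) γ hγ hγ1 K), (∀ K, (p K).a₀ = a₀ ∧ (p K).a₁ = a₁) ∧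
            ∃ (Φ : ChartFam ↥(lieC (suGroupModel 2)) F) (e : VacFam F) (B : CfgFam ↥(lieC (suGroupModel 2)) F),
              KernelRefΦ (AlphaInputsT3AC.dataOfV4chi p (canonPolymerRows fun K => (p K).toRows)) Φ Ψ (canonLegDist F) κ' (hF ▸ 𝔠).κ a C ∧
              KernelLegPointwiseΦ (AlphaInputsT3AC.dataOfV4chi p (canonPolymerRows fun K => (p K).toRows)) Φ (canonLegDist F) κ₁ (hF ▸ 𝔠).κ A ∧
              RemainderSmallΦ (AlphaInputsT3AC.dataOfV4chi p (canonPolymerRows fun K => (p K).toRows)) (residualRemRows (fun K => (p K).toRows) Φ e B)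
                (hF ▸ 𝔠).b₀ (hF ▸ 𝔠).p₀ (hF ▸ 𝔠).κ C_R ∧
              CfgDistΦ (AlphaInputsT3AC.dataOfV4chi p (canonPolymerRows fun K => (p K).toRows)) B (canonLegDist F) (hF ▸ 𝔠).b₀ (hF ▸ 𝔠).p₀ C_s ∧
              CfgRefΦ (AlphaInputsT3AC.dataOfV4chi p (canonPolymerRows fun K => (p K).toRows)) B BR (canonLegDist F) (hF ▸ 𝔠).b₀ (hF ▸ 𝔠).p₀ a C_B)

/-- **THE PER-RUN SOCKET GIVES 3⁗χ'S SOCKET OF RECORD**: `K1aLegRowsRefChiV4 → K1aLegRowsRChiV4` (constants `2C`, `2C_B`; `flatKernelLegCauchyΦ_of_ref`, `cfgDistCauchyΦ_of_ref`).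
[cite: King1986, Prop. 3.6 (3.56) p.662, Prop. 3.9 (3.71)-(3.74) p.665] -/
theorem k1aLegRowsRChiV4_of_RefChiV4 {L : ℕ} {𝔠 : AlphaConsts L (suGroupModel 2).N} {a₀ a₁ a : ℝ} (h : K1aLegRowsRefChiV4 L 𝔠 a₀ a₁ a) :
    K1aLegRowsRChiV4 L 𝔠 a₀ a₁ a := by
  obtain ⟨κ', κ₁, C, A, C_R, C_s, C_B, γB, hκ', hκ1, hC, hA, hCR, hCs, hCB, hγB, hall⟩ := h
  refine ⟨κ', κ₁, 2 * C, A, C_R, C_s, 2 * C_B, γB, hκ', hκ1, by linarith, hA, hCR, hCs, by linarith, hγB,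
    fun F γ hF hγ hγle hγ1 hOf => ?_⟩
  obtain ⟨Ψ, BR, hΨ, hBR, himp⟩ := hall F γ hF hγ hγle hγ1
  obtain ⟨p, hp, Φ, e, B, hK, hP, hR, hS, hBC⟩ := himp hOf
  exact ⟨p, hp, Φ, e, B, flatKernelLegCauchyΦ_of_ref hΨ hK, hP, hR, hS, cfgDistCauchyΦ_of_ref hBR hBC⟩

/-- **3⁗χ WITH THE KERNELS PER-RUN ONLY** (hypothesis schema, never asserted): `K1aLegRowsRChiV4` with K1a `FlatKernelLegCauchyΦ` replaced by `KernelRefΦ` against a height-free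
reference family quantified before the (α) hypothesis; the loop-variable comparison `CfgDistCauchyΦ` is kept in its two-run form (the 19200-side statement as the
variational problem delivers it). [cite: King1986, Thm 3.4 (3.9) p.656, Prop. 3.6 (3.56) p.662; Balaban1985UV3, (43)-(45) pp.266-267, (57) p.270] -/
def K1aLegRowsRefKChiV4 (L : ℕ) (𝔠 : AlphaConsts L (suGroupModel 2).N) (a₀ a₁ a : ℝ) : Prop :=
  ∃ (κ' κ₁ C A C_R C_s C_B γB : ℝ), 0 < κ' ∧ κ' < κ₁ ∧ 0 ≤ C ∧ 0 ≤ A ∧ 0 ≤ C_R ∧ 0 ≤ C_s ∧ 0 ≤ C_B ∧ 0 < γB ∧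
    ∀ (F : T3Family) (γ : ℝ) (hF : F.L = L) (hγ : 0 < γ), γ ≤ γB → ∀ (hγ1 : γ ≤ (min (hF ▸ 𝔠).gamma0 1) ^ 2),
      ∃ (Ψ : ChartFam ↥(lieC (suGroupModel 2)) F), KerHeightFree Ψ ∧
        (AlphaInputsT3AC.OfV4ChiAt F (hF ▸ 𝔠) a₀ a₁ →
          ∃ (p : ∀ K, AlphaInputsT3AC.PkgAtV4Chi F (hF ▸ 𝔠) γ hγ hγ1 K), (∀ K, (p K).a₀ = a₀ ∧ (p K).a₁ = a₁) ∧
            ∃ (Φ : ChartFam ↥(lieC (suGroupModel 2)) F) (e : VacFam F) (B : CfgFam ↥(lieC (suGroupModel 2)) F),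
              KernelRefΦ (AlphaInputsT3AC.dataOfV4chi p (canonPolymerRows fun K => (p K).toRows)) Φ Ψ (canonLegDist F) κ' (hF ▸ 𝔠).κ a C ∧
              KernelLegPointwiseΦ (AlphaInputsT3AC.dataOfV4chi p (canonPolymerRows fun K => (p K).toRows)) Φ (canonLegDist F) κ₁ (hF ▸ 𝔠).κ A ∧
              RemainderSmallΦ (AlphaInputsT3AC.dataOfV4chi p (canonPolymerRows fun K => (p K).toRows)) (residualRemRows (fun K => (p K).toRows) Φ e B)
                (hF ▸ 𝔠).b₀ (hF ▸ 𝔠).p₀ (hF ▸ 𝔠).κ C_R ∧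
              CfgDistΦ (AlphaInputsT3AC.dataOfV4chi p (canonPolymerRows fun K => (p K).toRows)) B (canonLegDist F) (hF ▸ 𝔠).b₀ (hF ▸ 𝔠).p₀ C_s ∧
              CfgDistCauchyΦ (AlphaInputsT3AC.dataOfV4chi p (canonPolymerRows fun K => (p K).toRows)) B (canonLegDist F) (hF ▸ 𝔠).b₀ (hF ▸ 𝔠).p₀ a C_B)

/-- The kernels-per-run socket gives the socket of record: `K1aLegRowsRefKChiV4 → K1aLegRowsRChiV4` (constant `2C`). [cite: King1986, Prop. 3.6 (3.56) p.662] -/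
theorem k1aLegRowsRChiV4_of_RefKChiV4 {L : ℕ} {𝔠 : AlphaConsts L (suGroupModel 2).N} {a₀ a₁ a : ℝ} (h : K1aLegRowsRefKChiV4 L 𝔠 a₀ a₁ a) :
    K1aLegRowsRChiV4 L 𝔠 a₀ a₁ a := by
  obtain ⟨κ', κ₁, C, A, C_R, C_s, C_B, γB, hκ', hκ1, hC, hA, hCR, hCs, hCB, hγB, hall⟩ := h
  refine ⟨κ', κ₁, 2 * C, A, C_R, C_s, C_B, γB, hκ', hκ1, by linarith, hA, hCR, hCs, hCB, hγB, fun F γ hF hγ hγle hγ1 hOf => ?_⟩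
  obtain ⟨Ψ, hΨ, himp⟩ := hall F γ hF hγ hγle hγ1
  obtain ⟨p, hp, Φ, e, B, hK, hP, hR, hS, hBC⟩ := himp hOf
  exact ⟨p, hp, Φ, e, B, flatKernelLegCauchyΦ_of_ref hΨ hK, hP, hR, hS, hBC⟩

/-- **THE REGISTERED STUB 3⁗χ FROM THE PER-RUN SOCKET, BY NAME** (`globalTwoRunSlackFamChiV4_of_k1aLegRowsRChiV4 ∘ k1aLegRowsRChiV4_of_RefChiV4`): if for every odd `L ≥ 7`, every
constants record and [7]-constants there is a rate exponent `0 < a < 1` with `K1aLegRowsRefChiV4 L 𝔠 a₀ a₁ a`, then the text of `stub_globalTwoRunSlackFamChiV4` (skeleton v5kC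
of stmt-QuantumFields-20520) holds VERBATIM. [cite: King1986, Thm 3.4 (3.9) p.656, Prop. 3.6 (3.56) p.662; Balaban1985UV3, (43)-(47) pp.266-267, (57) p.270] -/
theorem globalTwoRunSlackFamChiV4_of_k1aLegRowsRefChiV4
    (h : ∀ (L : ℕ), Odd L → 7 ≤ L → ∀ (𝔠 : AlphaConsts L (suGroupModel 2).N) (a₀ a₁ : ℝ), 0 < a₀ → 0 < a₁ → 𝔠.B₃ * a₁ ≤ a₀ →
      ∃ a : ℝ, 0 < a ∧ a < 1 ∧ K1aLegRowsRefChiV4 L 𝔠 a₀ a₁ a) :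
    ∀ (L : ℕ), Odd L → 7 ≤ L → ∀ (𝔠 : Summit.QuantumFields.Balaban3D.Proofs.Primitives.AlphaConsts L (Summit.QuantumFields.Balaban3D.Carriers.suGroupModel 2).N)
      (a₀ a₁ : ℝ), 0 < a₀ → 0 < a₁ → 𝔠.B₃ * a₁ ≤ a₀ →
      ∃ a : ℝ, 0 < a ∧ ∃ γB : ℝ, 0 < γB ∧ ∀ (F : T3Family) (γ : ℝ) (hF : F.L = L) (hγ : 0 < γ), γ ≤ γB →
        ∀ (hγ1 : γ ≤ (min (hF ▸ 𝔠).gamma0 1) ^ 2),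
          Summit.QuantumFields.YangMills.Theorems.AlphaInputsT3AC.OfV4ChiAt F (hF ▸ 𝔠) a₀ a₁ →
          ∃ (p : ∀ K, Summit.QuantumFields.YangMills.Theorems.AlphaInputsT3AC.PkgAtV4Chi F (hF ▸ 𝔠) γ hγ hγ1 K),
            (∀ K, (p K).a₀ = a₀ ∧ (p K).a₁ = a₁) ∧
            ∃ (π : Summit.QuantumFields.YangMills.Theorems.AlphaInputsT3AC.PolymerT3 F) (σ : ℕ) (C : ℝ), 7 ≤ σ ∧ 0 ≤ C ∧
              Summit.QuantumFields.YangMills.Theorems.GlobalSlack.GlobalSupRateTSlack (Summit.QuantumFields.YangMills.Theorems.AlphaInputsT3AC.dataOfV4chi p π) (hF ▸ 𝔠).b₀ (hF ▸ 𝔠).p₀ a σ C :=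
  globalTwoRunSlackFamChiV4_of_k1aLegRowsRChiV4 fun L hLo h7 𝔠 a₀ a₁ ha0 ha1 hw => by
    obtain ⟨a, ha, ha1', hc⟩ := h L hLo h7 𝔠 a₀ a₁ ha0 ha1 hw
    exact ⟨a, ha, ha1', k1aLegRowsRChiV4_of_RefChiV4 hc⟩

/-- **THE REGISTERED STUB 3⁗χ FROM THE KERNELS-PER-RUN SOCKET, BY NAME** (`globalTwoRunSlackFamChiV4_of_k1aLegRowsRChiV4 ∘ k1aLegRowsRChiV4_of_RefKChiV4`).
[cite: King1986, Thm 3.4 (3.9) p.656, Prop. 3.6 (3.56) p.662; Balaban1985UV3, (43)-(47) pp.266-267, (57) p.270] -/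
theorem globalTwoRunSlackFamChiV4_of_k1aLegRowsRefKChiV4
    (h : ∀ (L : ℕ), Odd L → 7 ≤ L → ∀ (𝔠 : AlphaConsts L (suGroupModel 2).N) (a₀ a₁ : ℝ), 0 < a₀ → 0 < a₁ → 𝔠.B₃ * a₁ ≤ a₀ →
      ∃ a : ℝ, 0 < a ∧ a < 1 ∧ K1aLegRowsRefKChiV4 L 𝔠 a₀ a₁ a) :
    ∀ (L : ℕ), Odd L → 7 ≤ L → ∀ (𝔠 : Summit.QuantumFields.Balaban3D.Proofs.Primitives.AlphaConsts L (Summit.QuantumFields.Balaban3D.Carriers.suGroupModel 2).N)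
      (a₀ a₁ : ℝ), 0 < a₀ → 0 < a₁ → 𝔠.B₃ * a₁ ≤ a₀ →
      ∃ a : ℝ, 0 < a ∧ ∃ γB : ℝ, 0 < γB ∧ ∀ (F : T3Family) (γ : ℝ) (hF : F.L = L) (hγ : 0 < γ), γ ≤ γB →
        ∀ (hγ1 : γ ≤ (min (hF ▸ 𝔠).gamma0 1) ^ 2),
          Summit.QuantumFields.YangMills.Theorems.AlphaInputsT3AC.OfV4ChiAt F (hF ▸ 𝔠) a₀ a₁ →
          ∃ (p : ∀ K, Summit.QuantumFields.YangMills.Theorems.AlphaInputsT3AC.PkgAtV4Chi F (hF ▸ 𝔠) γ hγ hγ1 K),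
            (∀ K, (p K).a₀ = a₀ ∧ (p K).a₁ = a₁) ∧
            ∃ (π : Summit.QuantumFields.YangMills.Theorems.AlphaInputsT3AC.PolymerT3 F) (σ : ℕ) (C : ℝ), 7 ≤ σ ∧ 0 ≤ C ∧
              Summit.QuantumFields.YangMills.Theorems.GlobalSlack.GlobalSupRateTSlack (Summit.QuantumFields.YangMills.Theorems.AlphaInputsT3AC.dataOfV4chi p π) (hF ▸ 𝔠).b₀ (hF ▸ 𝔠).p₀ a σ C :=
  globalTwoRunSlackFamChiV4_of_k1aLegRowsRChiV4 fun L hLo h7 𝔠 a₀ a₁ ha0 ha1 hw => by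
    obtain ⟨a, ha, ha1', hc⟩ := h L hLo h7 𝔠 a₀ a₁ ha0 ha1 hw
    exact ⟨a, ha, ha1', k1aLegRowsRChiV4_of_RefKChiV4 hc⟩

end Summit.QuantumFields.YangMills.Theorems.GlobalSlackKernelLeg

end
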